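import Summits.MatrixMultiplication.OmegaCensus.STPP222DensityTen

/-!
# ω-census (abelian STPP census): near-periods from translate counts and the Kneser–energy inequality (abstract part of filter N11)

HONEST FRAMING (pub-omega census; verbatim): lottery ticket; floor = certified bounds/negative ranges.
Census BOOKKEEPING (seat pub-omega-stpp-1 gen 25, 2026-08-27), family (b2).  Abstract additive combinatorics in a finite abelian group
`H` used by the census filter N11 (`STPPNearPeriodFilter.lean`); nothing here is progress on `ω`.

For finsets `S, W, R ⊆ H` and a bound `t`, each of the three "translate" hypotheses — every `S + w`, resp. `w − S`, resp. `S − w`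
(`w ∈ W`) meets `R` in at most `t` points — makes every difference of `W` a NEAR-PERIOD of `S`:
`dif S (±(w − w')) = |S ∩ (S + (w − w'))| ≥ σ := 2|S| − 2t − (|H| − |R|)` (two translates sit in `H ∖ R` up to `t` points each; inclusion–
exclusion; the intersection injects into `S ∩ (S + δ)`): `le_dif_of_translate_add_le`, `le_dif_of_translate_sub_le`,
`le_dif_of_translate_sub_right_le` (the cube special case `t = 2`, `|S| = |R|` is `le_dif_of_translate` of `STPP222DensityBound.lean`).
ENERGY: `Σ_δ dif S δ = |S|²` and `dif S 0 = |S|` give `(#D − 1)·σ + |S| ≤ |S|²` for any `D ∋ 0` of `σ`-near-periods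
(`card_sub_one_mul_add_card_le`); with KNESER (tree `STPPKneser.exists_dvd_kneserLB_le_card_add`: `#(W − W) ≥ kneserLB(|W|,|W|,d)` for the
divisor `d = #Stab(W − W)` of `|H|`) this is the Kneser–energy inequality `exists_dvd_kneserLB_energy` and its numeric contradiction form
`false_of_forall_dvd_energy_lt` (bounded divisor quantifier, the shape of `N8Dead`).

References: M. Kneser, Math. Z. 58 (1953); M. B. Nathanson, *Additive Number Theory: Inverse Problems*, GTM 165, §4.
-/

open Finset
open scoped Pointwise

namespace Summit.MatrixMultiplication.OmegaCensus.CubeNB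

variable {H : Type*} [AddCommGroup H] [DecidableEq H]

/-! ## §1 Abstract: near-periods from translate counts (three shapes), the energy bound, the Kneser–energy inequality -/

section Abstract

variable [Fintype H] {S W R : Finset H} {t : ℕ}

/-- Near-periods, shape `s + w`: if every translate `S + w` (`w ∈ W`) meets `R` in at most `t` points then for `w, w' ∈ W`:
`dif S (w − w') ≥ 2|S| − 2t − (|H| − |R|)`. [folklore] -/
theorem le_dif_of_translate_add_le (ht : ∀ w ∈ W, #(S.filter fun s => s + w ∈ R) ≤ t) {w w' : H} (hw : w ∈ W)
    (hw' : w' ∈ W) : 2 * #S + #R ≤ dif S (w - w') + 2 * t + Fintype.card H := by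
  set U := S.filter fun s => s + w ∉ R with hU
  set U' := S.filter fun s => s + w' ∉ R with hU'
  have hUm : #S ≤ #U + t := by
    have h := card_filter_add_card_filter_not (s := S) (fun s => s + w ∈ R)
    have := ht w hw
    simp only [hU]; omega
  have hU'm : #S ≤ #U' + t := by
    have h := card_filter_add_card_filter_not (s := S) (fun s => s + w' ∈ R)
    have := ht w' hw'
    simp only [hU']; omega
  set T := U.image fun s => s + w with hT
  set T' := U'.image fun s => s + w' with hT'
  have hTc : #T = #U := card_image_of_injective _ (add_left_injective w)
  have hT'c : #T' = #U' := card_image_of_injective _ (add_left_injective w')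
  have hdisj : Disjoint (T ∪ T') R := by
    rw [disjoint_left]
    intro g hg hgR
    rcases mem_union.1 hg with hg | hg
    · obtain ⟨s, hs, rfl⟩ := mem_image.1 hg; exact (mem_filter.1 hs).2 hgR
    · obtain ⟨s, hs, rfl⟩ := mem_image.1 hg; exact (mem_filter.1 hs).2 hgR
  have hUR : #(T ∪ T') + #R ≤ Fintype.card H := by
    rw [← card_union_of_disjoint hdisj]; exact card_le_univ _
  have hIE := card_union_add_card_inter T T'
  have hinj : #(T ∩ T') ≤ dif S (w - w') := by
    rw [dif, ← card_image_of_injective (T ∩ T') (sub_left_injective (b := w'))]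
    refine card_le_card fun s hs => ?_
    obtain ⟨g, hg, rfl⟩ := mem_image.1 hs
    obtain ⟨hg1, hg2⟩ := mem_inter.1 hg
    obtain ⟨s₁, hs₁, hgs₁⟩ := mem_image.1 hg1
    obtain ⟨s₂, hs₂, hgs₂⟩ := mem_image.1 hg2
    rw [mem_filter]
    refine ⟨?_, ?_⟩
    · rw [← hgs₂, add_sub_cancel_right]; exact (mem_filter.1 hs₂).1
    · have e : g - w' - (w - w') = s₁ := by rw [← hgs₁]; abel
      rw [e]; exact (mem_filter.1 hs₁).1
  omega

/-- Near-periods, shape `w − s`: if every `w − S` (`w ∈ W`) meets `R` in at most `t` points then for `w, w' ∈ W`: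
`dif S (w' − w) ≥ 2|S| − 2t − (|H| − |R|)`. [folklore] -/
theorem le_dif_of_translate_sub_le (ht : ∀ w ∈ W, #(S.filter fun s => w - s ∈ R) ≤ t) {w w' : H} (hw : w ∈ W)
    (hw' : w' ∈ W) : 2 * #S + #R ≤ dif S (w' - w) + 2 * t + Fintype.card H := by
  set U := S.filter fun s => w - s ∉ R with hU
  set U' := S.filter fun s => w' - s ∉ R with hU'
  have hUm : #S ≤ #U + t := by
    have h := card_filter_add_card_filter_not (s := S) (fun s => w - s ∈ R)
    have := ht w hw
    simp only [hU]; omega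
  have hU'm : #S ≤ #U' + t := by
    have h := card_filter_add_card_filter_not (s := S) (fun s => w' - s ∈ R)
    have := ht w' hw'
    simp only [hU']; omega
  set T := U.image fun s => w - s with hT
  set T' := U'.image fun s => w' - s with hT'
  have hTc : #T = #U := card_image_of_injective _ sub_right_injective
  have hT'c : #T' = #U' := card_image_of_injective _ sub_right_injective
  have hdisj : Disjoint (T ∪ T') R := by
    rw [disjoint_left]
    intro g hg hgR
    rcases mem_union.1 hg with hg | hg
    · obtain ⟨s, hs, rfl⟩ := mem_image.1 hg; exact (mem_filter.1 hs).2 hgR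
    · obtain ⟨s, hs, rfl⟩ := mem_image.1 hg; exact (mem_filter.1 hs).2 hgR
  have hUR : #(T ∪ T') + #R ≤ Fintype.card H := by
    rw [← card_union_of_disjoint hdisj]; exact card_le_univ _
  have hIE := card_union_add_card_inter T T'
  have hinj : #(T ∩ T') ≤ dif S (w' - w) := by
    rw [dif, ← card_image_of_injective (T ∩ T') (sub_right_injective (b := w'))]
    refine card_le_card fun s hs => ?_
    obtain ⟨g, hg, rfl⟩ := mem_image.1 hs
    obtain ⟨hg1, hg2⟩ := mem_inter.1 hg
    obtain ⟨s₁, hs₁, hgs₁⟩ := mem_image.1 hg1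
    obtain ⟨s₂, hs₂, hgs₂⟩ := mem_image.1 hg2
    rw [mem_filter]
    refine ⟨?_, ?_⟩
    · rw [← hgs₂, sub_sub_cancel]; exact (mem_filter.1 hs₂).1
    · have e : w' - g - (w' - w) = s₁ := by rw [← hgs₁]; abel
      rw [e]; exact (mem_filter.1 hs₁).1
  omega

/-- Near-periods, shape `s − w`: if every `S − w` (`w ∈ W`) meets `R` in at most `t` points then for `w, w' ∈ W`:
`dif S (w' − w) ≥ 2|S| − 2t − (|H| − |R|)`. [folklore] -/
theorem le_dif_of_translate_sub_right_le (ht : ∀ w ∈ W, #(S.filter fun s => s - w ∈ R) ≤ t) {w w' : H} (hw : w ∈ W)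
    (hw' : w' ∈ W) : 2 * #S + #R ≤ dif S (w' - w) + 2 * t + Fintype.card H := by
  set U := S.filter fun s => s - w ∉ R with hU
  set U' := S.filter fun s => s - w' ∉ R with hU'
  have hUm : #S ≤ #U + t := by
    have h := card_filter_add_card_filter_not (s := S) (fun s => s - w ∈ R)
    have := ht w hw
    simp only [hU]; omega
  have hU'm : #S ≤ #U' + t := by
    have h := card_filter_add_card_filter_not (s := S) (fun s => s - w' ∈ R)
    have := ht w' hw'
    simp only [hU']; omega
  set T := U.image fun s => s - w with hT
  set T' := U'.image fun s => s - w' with hT'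
  have hTc : #T = #U := card_image_of_injective _ (sub_left_injective (b := w))
  have hT'c : #T' = #U' := card_image_of_injective _ (sub_left_injective (b := w'))
  have hdisj : Disjoint (T ∪ T') R := by
    rw [disjoint_left]
    intro g hg hgR
    rcases mem_union.1 hg with hg | hg
    · obtain ⟨s, hs, rfl⟩ := mem_image.1 hg; exact (mem_filter.1 hs).2 hgR
    · obtain ⟨s, hs, rfl⟩ := mem_image.1 hg; exact (mem_filter.1 hs).2 hgR
  have hUR : #(T ∪ T') + #R ≤ Fintype.card H := by
    rw [← card_union_of_disjoint hdisj]; exact card_le_univ _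
  have hIE := card_union_add_card_inter T T'
  have hinj : #(T ∩ T') ≤ dif S (w' - w) := by
    rw [dif, ← card_image_of_injective (T ∩ T') (add_left_injective w')]
    refine card_le_card fun s hs => ?_
    obtain ⟨g, hg, rfl⟩ := mem_image.1 hs
    obtain ⟨hg1, hg2⟩ := mem_inter.1 hg
    obtain ⟨s₁, hs₁, hgs₁⟩ := mem_image.1 hg1
    obtain ⟨s₂, hs₂, hgs₂⟩ := mem_image.1 hg2
    rw [mem_filter]
    refine ⟨?_, ?_⟩
    · rw [← hgs₂, sub_add_cancel]; exact (mem_filter.1 hs₂).1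
    · have e : g + w' - (w' - w) = s₁ := by rw [← hgs₁]; abel
      rw [e]; exact (mem_filter.1 hs₁).1
  omega

/-- **Energy bound.**  If `0 ∈ D` and every `δ ∈ D` has `dif S δ ≥ σ`, then `(#D − 1)·σ + |S| ≤ |S|²`
(`Σ_δ dif S δ = |S|²`, `dif S 0 = |S|`). [folklore] -/
theorem card_sub_one_mul_add_card_le {D : Finset H} (h0 : (0 : H) ∈ D) {σ : ℕ} (hD : ∀ δ ∈ D, σ ≤ dif S δ) :
    (#D - 1) * σ + #S ≤ #S * #S := by
  have hsplit : ∑ δ ∈ D.erase 0, dif S δ + dif S 0 = ∑ δ ∈ D, dif S δ := sum_erase_add _ _ h0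
  have hle : ∑ δ ∈ D, dif S δ ≤ #S * #S := by
    rw [← sum_dif S]
    exact sum_le_sum_of_subset_of_nonneg (subset_univ D) fun _ _ _ => Nat.zero_le _
  have hlow : #(D.erase 0) * σ ≤ ∑ δ ∈ D.erase 0, dif S δ := by
    rw [← smul_eq_mul, ← sum_const]
    exact sum_le_sum fun δ hδ => hD δ (mem_of_mem_erase hδ)
  rw [dif_zero] at hsplit
  rw [card_erase_of_mem h0] at hlow
  omega

/-- **The Kneser–energy inequality.**  If `W ≠ ∅` and every difference `w − w'` (`w, w' ∈ W`) has `dif S (w − w') ≥ σ`, then for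
SOME divisor `d` of `|H|` (the order of `Stab(W − W)`): `(kneserLB(|W|,|W|,d) − 1)·σ + |S| ≤ |S|²`.
[cite: Kneser1953] [cite: Nathanson1996, §4.2] -/
theorem exists_dvd_kneserLB_energy (hW : W.Nonempty) {σ : ℕ} (hNP : ∀ w ∈ W, ∀ w' ∈ W, σ ≤ dif S (w - w')) :
    ∃ d : ℕ, 0 < d ∧ d ∣ Fintype.card H ∧ (STPPKneser.kneserLB #W #W d - 1) * σ + #S ≤ #S * #S := by
  obtain ⟨d, hd, hdvd, hk⟩ := STPPKneser.exists_dvd_kneserLB_le_card_add W (-W) hW hW.neg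
  rw [card_neg, ← sub_eq_add_neg] at hk
  refine ⟨d, hd, hdvd, ?_⟩
  obtain ⟨w₀, hw₀⟩ := hW
  have h0 : (0 : H) ∈ W - W := mem_sub.2 ⟨w₀, hw₀, w₀, hw₀, sub_self w₀⟩
  have hD : ∀ δ ∈ W - W, σ ≤ dif S δ := by
    intro δ hδ
    obtain ⟨w, hw, w', hw', rfl⟩ := mem_sub.1 hδ
    exact hNP w hw w' hw'
  have hE := card_sub_one_mul_add_card_le h0 hD
  have hmono : (STPPKneser.kneserLB #W #W d - 1) * σ ≤ (#(W - W) - 1) * σ :=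
    Nat.mul_le_mul_right σ (Nat.sub_le_sub_right hk 1)
  omega

/-- Numeric contradiction form: if every difference of `W ≠ ∅` is a `σ`-near-period of `S` with `σ ≥ 2|S| + |R| − 2t − |H|` (natural
subtraction) and EVERY divisor `d` of `|H| = n` has `|S|² < (kneserLB(|W|,|W|,d) − 1)·(2|S| + |R| − (2t + n)) + |S|`, contradiction.
[cite: Kneser1953] -/
theorem false_of_forall_dvd_energy_lt (hW : W.Nonempty) {n : ℕ} (hn : Fintype.card H = n)
    (hNP : ∀ w ∈ W, ∀ w' ∈ W, 2 * #S + #R ≤ dif S (w - w') + 2 * t + Fintype.card H)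
    (h : ∀ d : ℕ, d < n + 1 → d ∣ n → 0 < d →
      #S * #S < (STPPKneser.kneserLB #W #W d - 1) * (2 * #S + #R - (2 * t + n)) + #S) : False := by
  have hNP' : ∀ w ∈ W, ∀ w' ∈ W, 2 * #S + #R - (2 * t + n) ≤ dif S (w - w') := by
    intro w hw w' hw'
    have := hNP w hw w' hw'
    omega
  obtain ⟨d, hd, hdvd, hle⟩ := exists_dvd_kneserLB_energy hW hNP'
  rw [hn] at hdvd
  have hnpos : 0 < n := hn ▸ Fintype.card_pos
  have := h d (Nat.lt_succ_of_le (Nat.le_of_dvd hnpos hdvd)) hdvd hd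
  omega

end Abstract

end Summit.MatrixMultiplication.OmegaCensus.CubeNB
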